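import Summits.CriticalPhenomena.PercolationContinuityZ3.Theorems.Transplant.PlanarSkeletonConcBoxProd
import Summits.CriticalPhenomena.PercolationContinuityZ3.Theorems.Transplant.HeisenbergSkeletonConc
import Summits.CriticalPhenomena.PercolationContinuityZ3.Theorems.Transplant.HeisenbergZSkeletonConc
import Summits.CriticalPhenomena.PercolationContinuityZ3.Theorems.Transplant.HeisenbergKSkeletonConc
import Summits.CriticalPhenomena.PercolationContinuityZ3.Theorems.Transplant.BoxProdHeisenberg
import Summits.CriticalPhenomena.PercolationContinuityZ3.Theorems.Transplant.BoxProdHeisenbergZ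
import Summits.CriticalPhenomena.PercolationContinuityZ3.Theorems.Transplant.HeisenbergKBoxProd
import HarnessLib

/-!
# Benjamini–Schramm's Conjecture 4 for `X □ H₃(ℤ)`, `X □ (H₃(ℤ) × ℤ)`, `X □ H_{2k+1}(ℤ)` from the node of record `SamePDropOfSkeletonConcLt`
# (the three product instances of the design-(D) interface `PlanarSkeletonConc`)

builds on p205010 (kernel theorem, internal audit signed; external expert review pending) — nothing in this file uses p205010.
Status sentence (coordinator 2026-08-20T04:30Z): "θ(p_c) = 0 on ℤ^d, all d ≥ 2 — kernel-verified (Lean 4/Mathlib, standard axioms);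
internal adversarial audit SIGNED 2026-08-20 04:29Z; external expert review pending."

Lane `prim-bschramm`, seat `prim-bschramm-p4` (gen 5; class map, memo `P4-GENERAL.md` §13), helper file
(`--supports stmt-CriticalPhenomena-4575`).  The generic product rung `bsConj4_boxProd_of_skeletonConcNode` (`PlanarSkeletonConcBoxProd.lean`)
fed with the three instances `heisSkeletonConc`, `hzSkeletonConc`, `hkSkeletonConc hjj` and the tree's product-cylinder inputs Φ2
(`boxProdHeisSkeleton_cylSubcritical` p4-g3, `boxProdHZSkeleton_cylSubcritical` p4-g3, `boxProdHKSkeleton_cylSubcritical` p4-g4 — all via the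
product slab–quotient criterion, Martineau–Severo), polynomial growth of the second factor (degrees `4`, `5`, `2k+2`) and `p_c < 1` of the second
factor: for every connected, locally finite, quasi-transitive `X`,
* `bsConj4_boxProdHeisenberg_of_skeletonConcNode` — `θ_{X □ H₃(ℤ)}(v, p_c) = 0` at every vertex;
* `bsConj4_boxProdHeisenbergZ_of_skeletonConcNode` — `θ_{X □ (H₃(ℤ)×ℤ)}(v, p_c) = 0`;
* `bsConj4_boxProdHeisenbergK_of_skeletonConcNode(')` — `θ_{X □ H_{2k+1}(ℤ)}(v, p_c) = 0` (`j' ≠ j`, resp. `k ≥ 2`);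
each CONDITIONAL on the node of record `SamePDropOfSkeletonConcLt` ONLY (the design-(D) drop node at `p < 1`; NOT proved, never asserted).
[cite: BenjaminiSchramm1996, Conj. 4; §2 (almost transitive graphs)] [cite: Hutchcroft2016, Thm. 1] [cite: MartineauSevero2019, Cor. 2.2]
[cite: KozmaNitzan2024, §1 p. 2 (approach 1)]
-/

noncomputable section

namespace Summit.CriticalPhenomena.PercolationContinuityZ3.Theorems.Transplant

open MeasureTheory Literature.Probability.Percolation Literature.Probability.LatticeModels SimpleGraph
open Literature.Geometry.MetricEmbeddings (cayleyGraph cayleyGraph_connected)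
open Literature.Barriers.CriticalPhenomena (IsQuasiTransitive IsGraphAmenable)
open HeisenbergZ

variable {W : Type} [DecidableEq W]

/-- **Conjecture 4 for `X □ H₃(ℤ)` from the node of record** (`X` connected, locally finite, quasi-transitive): every vertex.
Conditional on `SamePDropOfSkeletonConcLt` only. [cite: BenjaminiSchramm1996, Conj. 4] [cite: Hutchcroft2016, Thm. 1] -/
theorem bsConj4_boxProdHeisenberg_of_skeletonConcNode (hD : SamePDropOfSkeletonConcLt) (X : SimpleGraph W) [X.LocallyFinite]
    (hc : X.Connected) (hq : IsQuasiTransitive X) (v : W × (ℤ × ℤ × ℤ)) :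
    theta (X □ cayleyGraph) v (criticalProbIOf (X □ cayleyGraph) v) = 0 :=
  bsConj4_boxProd_of_skeletonConcNode hD X hc hq heisSkeletonConc cayleyGraph_connected isQuasiTransitive_heisenberg 4
    ballVolume_heisenberg_le criticalProb_heisenberg_lt_one (fun t _ => boxProdHeisSkeleton_cylSubcritical X hc hq t) v

/-- **Conjecture 4 for `X □ (H₃(ℤ) × ℤ)` from the node of record** (`X` connected, locally finite, quasi-transitive): every vertex.
Conditional on `SamePDropOfSkeletonConcLt` only. [cite: BenjaminiSchramm1996, Conj. 4] [cite: Hutchcroft2016, Thm. 1] -/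
theorem bsConj4_boxProdHeisenbergZ_of_skeletonConcNode (hD : SamePDropOfSkeletonConcLt) (X : SimpleGraph W) [X.LocallyFinite]
    (hc : X.Connected) (hq : IsQuasiTransitive X) (v : W × HZ) :
    theta (X □ heisenbergZGraph) v (criticalProbIOf (X □ heisenbergZGraph) v) = 0 :=
  bsConj4_boxProd_of_skeletonConcNode hD X hc hq hzSkeletonConc heisenbergZGraph_connected heisenbergZGraph_quasiTransitive 5
    ballVolume_heisenbergZ_le criticalProb_heisenbergZ_lt_one (fun t _ => boxProdHZSkeleton_cylSubcritical X hc hq t) v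

/-- **Conjecture 4 for `X □ H_{2k+1}(ℤ)` from the node of record**, given two generator pairs `j' ≠ j` (`X` connected, locally finite,
quasi-transitive): every vertex. Conditional on `SamePDropOfSkeletonConcLt` only. [cite: BenjaminiSchramm1996, Conj. 4] [cite: Hutchcroft2016, Thm. 1] -/
theorem bsConj4_boxProdHeisenbergK_of_skeletonConcNode (hD : SamePDropOfSkeletonConcLt) {k : ℕ} {j j' : Fin k} (hjj : j' ≠ j)
    (X : SimpleGraph W) [X.LocallyFinite] (hc : X.Connected) (hq : IsQuasiTransitive X) (v : W × HK k) :
    theta (X □ hkGraph k) v (criticalProbIOf (X □ hkGraph k) v) = 0 :=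
  bsConj4_boxProd_of_skeletonConcNode hD X hc hq (hkSkeletonConc hjj) (hkGraph_connected hjj) hkGraph_quasiTransitive (2 * k + 2)
    ballVolume_hkGraph_le (criticalProb_hkGraph_lt_one hjj) (fun t _ => boxProdHKSkeleton_cylSubcritical X hc hq hjj t) v

/-- **Conjecture 4 for `X □ H_{2k+1}(ℤ)`, every `k ≥ 2`, from the node of record.** [cite: BenjaminiSchramm1996, Conj. 4] -/
theorem bsConj4_boxProdHeisenbergK_of_skeletonConcNode' (hD : SamePDropOfSkeletonConcLt) {k : ℕ} (hk : 2 ≤ k)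
    (X : SimpleGraph W) [X.LocallyFinite] (hc : X.Connected) (hq : IsQuasiTransitive X) (v : W × HK k) :
    theta (X □ hkGraph k) v (criticalProbIOf (X □ hkGraph k) v) = 0 := by
  obtain ⟨j, j', hjj⟩ := exists_two_pairs hk
  exact bsConj4_boxProdHeisenbergK_of_skeletonConcNode hD hjj X hc hq v

end Summit.CriticalPhenomena.PercolationContinuityZ3.Theorems.Transplant

end
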